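import Mathlib
import Summits.Ventures.LatticeQCDFlow.Scaling.GroupLayerHaar
import Summits.Ventures.LatticeQCDFlow.Scaling.U1PlaquetteLayer

/-!
# LatticeQCDFlow / Scaling — the layer plaquette for a general compact gauge group, and the
# TUBE INTEGRAL `θ⁴ · Re tr ρ(U_q(e'))`

HONEST FRAMING: exact (Metropolis-corrected) sampling algorithms for lattice gauge theory;
figures of merit are autocorrelation/cost numbers at stated couplings and volumes; no
continuum-physics claim.

Venture `LatticeQCDFlow` (cell pub-lqcd), topic `Scaling`, FANOUT row 30 (lean-1) — OUR WORK, file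
5 of the extension of the slab-chain proof of (LC)/(U′) to a general compact gauge group `G` with a
matrix representation `ρ` carrying one-link data `OneLink ρ θ` (`Scaling/GroupLayerHaar.lean`).  The
plaquette `q = (0; i, j)` of a layer has the four edges `pedge k` of `Scaling/U1PlaquetteLayer.lean`;
for a general group:
* `holG e = e(ℓ₀) e(ℓ₁) e(ℓ₂)⁻¹ e(ℓ₃)⁻¹` — its holonomy on the layer variables; `xObsG ρ e =
  Re tr ρ(holG e)` — THE OBSERVABLE of the crux (a plaquette `Re tr ρ(U_p)`);
  `integral_xObsG` (`∫ xObsG = 0`), **`integral_xObsG_sq`** (`∫ xObsG² = N θ`, the constant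
  `E[x²]` of the slab-chain theorem);
* `tubeWord u e' = u₀ e'₀ u₁ e'₁ e'₂⁻¹ u₂⁻¹ e'₃⁻¹ u₃⁻¹` — the word to which the lower plaquette
  holonomy reduces after the bond substitution of `Scaling/GroupSlabCost.lean` (sequel file);
* the ONE-BOND AVERAGING STEPS `integral_step_mul` / `integral_step_inv`: if the integrand is
  `Re tr ρ(u_p) · tr(X ρ(u_p) Y) · R` (resp. `ρ(u_p⁻¹)`) with `X, Y, R` blind to the bond `p`, then
  integrating replaces it by `θ · tr(X Y) · R` (`OneLink.integral_trRe_mul_trace`);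
* **`integral_tube`** — `∫ tr ρ(tubeWord u e') ∏_{k<4} Re tr ρ(u_k) du = θ⁴ · tr ρ(holG e')` (four
  steps) and **`integral_trRe_tube`** — `∫ Re tr ρ(tubeWord u e') ∏_k Re tr ρ(u_k) du =
  θ⁴ · xObsG ρ e'`: the `U(1)` eigenvalue `1/16` and the `SU(N)` tube factor `(2N)^{-4}`
  [cite: MontvayMunster1994, §3.6.2 (3.437)] in one statement.
Elementary; nothing is cited as a fact; `def`s `holG`, `xObsG`, `tubeWord`; no `sorry`.
-/

noncomputable section

open MeasureTheory Filter Finset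
open Literature.MathematicalPhysics.QuantumFieldTheory
open Summit.Ventures.LatticeQCDFlow.Theory2.Lattice.U1Layer (LSite LEdge zsite usite pedge
  pedge_injective)

namespace Summit.Ventures.LatticeQCDFlow.Theory2.GroupLayer

variable {G : Type*} [Group G] [TopologicalSpace G] [IsTopologicalGroup G] [CompactSpace G]
  [MeasurableSpace G] [BorelSpace G]
variable {d L : ℕ} [NeZero L] {a i j : Fin d} {N : ℕ} (ρ : G →* Matrix (Fin N) (Fin N) ℂ) {θ : ℝ}

/-! ## 1. The layer plaquette, its observable, and the tube word -/

omit [TopologicalSpace G] [IsTopologicalGroup G] [CompactSpace G] [MeasurableSpace G] [BorelSpace G] in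
/-- The holonomy of the layer plaquette `(0; i, j)`: `e(ℓ₀) e(ℓ₁) e(ℓ₂)⁻¹ e(ℓ₃)⁻¹`. [folklore] -/
def holG (hi : i ≠ a) (hj : j ≠ a) (e : LEdge d L a → G) : G :=
  e (pedge hi hj 0) * e (pedge hi hj 1) * (e (pedge hi hj 2))⁻¹ * (e (pedge hi hj 3))⁻¹

omit [TopologicalSpace G] [IsTopologicalGroup G] [CompactSpace G] [MeasurableSpace G] [BorelSpace G] in
/-- **The plaquette observable** of the layer, `xObsG ρ e = Re tr ρ(holG e)`. [folklore] -/
def xObsG (hi : i ≠ a) (hj : j ≠ a) (e : LEdge d L a → G) : ℝ := trRe ρ (holG hi hj e)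

omit [TopologicalSpace G] [IsTopologicalGroup G] [CompactSpace G] [MeasurableSpace G] [BorelSpace G] in
/-- **The tube word** `u₀ e'₀ u₁ e'₁ e'₂⁻¹ u₂⁻¹ e'₃⁻¹ u₃⁻¹` of two consecutive layers around the
plaquette. [folklore] -/
def tubeWord (hi : i ≠ a) (hj : j ≠ a) (u e' : LEdge d L a → G) : G :=
  u (pedge hi hj 0) * e' (pedge hi hj 0) * u (pedge hi hj 1) * e' (pedge hi hj 1) *
    (e' (pedge hi hj 2))⁻¹ * (u (pedge hi hj 2))⁻¹ * (e' (pedge hi hj 3))⁻¹ * (u (pedge hi hj 3))⁻¹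

variable (hi : i ≠ a) (hj : j ≠ a)

omit [CompactSpace G] [MeasurableSpace G] [BorelSpace G] [NeZero L] in
/-- `holG` is continuous. [folklore] -/
theorem continuous_holG : Continuous (holG (G := G) (L := L) hi hj) := by
  unfold holG; fun_prop

omit [CompactSpace G] [MeasurableSpace G] [BorelSpace G] [NeZero L] in
/-- `xObsG` is continuous. [folklore] -/
theorem continuous_xObsG (hρ : Continuous ρ) : Continuous (xObsG (L := L) ρ hi hj) :=
  (continuous_trRe ρ hρ).comp (continuous_holG hi hj)

omit [IsTopologicalGroup G] [MeasurableSpace G] [BorelSpace G] [NeZero L] in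
/-- `|xObsG| ≤ trReBound`. [folklore] -/
theorem abs_xObsG_le (hρ : Continuous ρ) (e : LEdge d L a → G) :
    |xObsG ρ hi hj e| ≤ trReBound (G := G) (ρ := ρ) hρ :=
  abs_trRe_le hρ _

omit [CompactSpace G] [MeasurableSpace G] [BorelSpace G] [NeZero L] in
/-- The tube word is jointly continuous. [folklore] -/
theorem continuous_tubeWord : Continuous fun p : (LEdge d L a → G) × (LEdge d L a → G) =>
    tubeWord hi hj p.1 p.2 := by
  unfold tubeWord; fun_prop

/-! ## 2. One-bond averaging steps -/

section Steps

variable [SecondCountableTopology G] {ρ}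

omit [Group G] [IsTopologicalGroup G] [MeasurableSpace G] [BorelSpace G] [SecondCountableTopology G]
  [NeZero L] in
/-- A continuous function on the compact Haar product is bounded. [folklore] -/
theorem exists_norm_le_of_continuous {ι : Type*} [Fintype ι] {F : (ι → G) → ℂ} (hF : Continuous F) :
    ∃ M : ℝ, ∀ u, ‖F u‖ ≤ M := by
  obtain ⟨M, hM⟩ := isCompact_univ.exists_bound_of_continuousOn hF.continuousOn
  exact ⟨M, fun u => hM u (Set.mem_univ u)⟩

omit [NeZero L] in
/-- **Averaging step, plain letter.**  If `X, Y, R` do not see the bond `p`, then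
`∫ Re tr ρ(u_p) · tr(X ρ(u_p) Y) · R du = θ · ∫ tr(X Y) · R du`. [folklore] -/
theorem integral_step_mul {ι : Type*} [Fintype ι] [DecidableEq ι] (h : OneLink ρ θ) (p : ι)
    {X Y : (ι → G) → Matrix (Fin N) (Fin N) ℂ} {R : (ι → G) → ℂ}
    (hXc : Continuous X) (hYc : Continuous Y) (hRc : Continuous R)
    (hX : ∀ (g : G) (u : ι → G), X ((Pi.mulSingle p g : ι → G) * u) = X u)
    (hY : ∀ (g : G) (u : ι → G), Y ((Pi.mulSingle p g : ι → G) * u) = Y u)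
    (hR : ∀ (g : G) (u : ι → G), R ((Pi.mulSingle p g : ι → G) * u) = R u) :
    ∫ u, (trRe ρ (u p) : ℂ) * (X u * ρ (u p) * Y u).trace * R u
        ∂(Measure.pi fun _ : ι => haarProbability G) =
      θ * ∫ u, (X u * Y u).trace * R u ∂(Measure.pi fun _ : ι => haarProbability G) := by
  have hc : Continuous fun u : ι → G => (trRe ρ (u p) : ℂ) * (X u * ρ (u p) * Y u).trace * R u :=
    (((Complex.continuous_ofReal.comp ((continuous_trRe ρ h.cont).comp (continuous_apply p))).mul
      ((hXc.matrix_mul (h.cont.comp (continuous_apply p))).matrix_mul hYc).matrix_trace).mul hRc)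
  obtain ⟨M, hM⟩ := exists_norm_le_of_continuous hc
  rw [integral_pi_eq_integral_average p hc.measurable hM]
  have hin : ∀ u : ι → G, ∫ g, (trRe ρ (((Pi.mulSingle p g : ι → G) * u) p) : ℂ) *
      (X ((Pi.mulSingle p g : ι → G) * u) * ρ (((Pi.mulSingle p g : ι → G) * u) p) *
        Y ((Pi.mulSingle p g : ι → G) * u)).trace * R ((Pi.mulSingle p g : ι → G) * u)
      ∂haarProbability G = θ * ((X u * Y u).trace * R u) := by
    intro u
    simp_rw [hX, hY, hR, mulSingle_mul_apply_same]
    have h1 := integral_mul_right_eq_self (μ := haarProbability G)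
      (fun g : G => (trRe ρ g : ℂ) * (X u * ρ g * Y u).trace * R u) (u p)
    rw [h1, integral_mul_const, integral_trRe_mul_trace h (X u) (Y u)]
    ring
  simp_rw [hin]
  exact integral_const_mul _ _

omit [NeZero L] in
/-- **Averaging step, inverted letter.**  If `X, Y, R` do not see the bond `p`, then
`∫ Re tr ρ(u_p) · tr(X ρ(u_p⁻¹) Y) · R du = θ · ∫ tr(X Y) · R du`. [folklore] -/
theorem integral_step_inv {ι : Type*} [Fintype ι] [DecidableEq ι] (h : OneLink ρ θ) (p : ι)
    {X Y : (ι → G) → Matrix (Fin N) (Fin N) ℂ} {R : (ι → G) → ℂ}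
    (hXc : Continuous X) (hYc : Continuous Y) (hRc : Continuous R)
    (hX : ∀ (g : G) (u : ι → G), X ((Pi.mulSingle p g : ι → G) * u) = X u)
    (hY : ∀ (g : G) (u : ι → G), Y ((Pi.mulSingle p g : ι → G) * u) = Y u)
    (hR : ∀ (g : G) (u : ι → G), R ((Pi.mulSingle p g : ι → G) * u) = R u) :
    ∫ u, (trRe ρ (u p) : ℂ) * (X u * ρ (u p)⁻¹ * Y u).trace * R u
        ∂(Measure.pi fun _ : ι => haarProbability G) =
      θ * ∫ u, (X u * Y u).trace * R u ∂(Measure.pi fun _ : ι => haarProbability G) := by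
  have hc : Continuous fun u : ι → G => (trRe ρ (u p) : ℂ) * (X u * ρ (u p)⁻¹ * Y u).trace * R u :=
    (((Complex.continuous_ofReal.comp ((continuous_trRe ρ h.cont).comp (continuous_apply p))).mul
      ((hXc.matrix_mul (h.cont.comp ((continuous_apply p).inv))).matrix_mul hYc).matrix_trace).mul
      hRc)
  obtain ⟨M, hM⟩ := exists_norm_le_of_continuous hc
  rw [integral_pi_eq_integral_average p hc.measurable hM]
  have hin : ∀ u : ι → G, ∫ g, (trRe ρ (((Pi.mulSingle p g : ι → G) * u) p) : ℂ) *
      (X ((Pi.mulSingle p g : ι → G) * u) * ρ (((Pi.mulSingle p g : ι → G) * u) p)⁻¹ *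
        Y ((Pi.mulSingle p g : ι → G) * u)).trace * R ((Pi.mulSingle p g : ι → G) * u)
      ∂haarProbability G = θ * ((X u * Y u).trace * R u) := by
    intro u
    simp_rw [hX, hY, hR, mulSingle_mul_apply_same]
    have h1 := integral_mul_right_eq_self (μ := haarProbability G)
      (fun g : G => (trRe ρ g : ℂ) * (X u * ρ g⁻¹ * Y u).trace * R u) (u p)
    rw [h1, integral_mul_const, integral_trRe_mul_trace_inv h (X u) (Y u)]
    ring
  simp_rw [hin]
  exact integral_const_mul _ _

end Steps

/-! ## 3. The plaquette observable: mean zero, second moment `N θ` -/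

section Plaquette

variable [SecondCountableTopology G] {ρ} (hij : i ≠ j)
include hij

omit [TopologicalSpace G] [IsTopologicalGroup G] [CompactSpace G] [MeasurableSpace G] [BorelSpace G]
  [SecondCountableTopology G] in
/-- Multiplying the first bond of the plaquette by `g` multiplies the holonomy by `g`. [folklore] -/
theorem holG_mulSingle_zero (hL : 2 ≤ L) (g : G) (e : LEdge d L a → G) :
    holG hi hj ((Pi.mulSingle (pedge hi hj 0) g : LEdge d L a → G) * e) = 1 * g * holG hi hj e := by
  have hinj := pedge_injective hi hj hij hL
  have h1 : pedge (L := L) hi hj 1 ≠ pedge hi hj 0 := fun h => by have := hinj h; simp at this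
  have h2 : pedge (L := L) hi hj 2 ≠ pedge hi hj 0 := fun h => by have := hinj h; simp at this
  have h3 : pedge (L := L) hi hj 3 ≠ pedge hi hj 0 := fun h => by have := hinj h; simp at this
  simp only [holG, mulSingle_mul_apply_same, mulSingle_mul_apply_ne h1, mulSingle_mul_apply_ne h2,
    mulSingle_mul_apply_ne h3, one_mul, mul_assoc]

/-- **`∫ xObsG = 0`** (average the first bond). [folklore] -/
theorem integral_xObsG (h : OneLink ρ θ) (hL : 2 ≤ L) :
    ∫ e, (xObsG ρ hi hj e : ℂ) ∂(Measure.pi fun _ : LEdge d L a => haarProbability G) = 0 := by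
  have hc : Continuous fun e : LEdge d L a → G => (xObsG ρ hi hj e : ℂ) :=
    Complex.continuous_ofReal.comp (continuous_xObsG ρ hi hj h.cont)
  obtain ⟨M, hM⟩ := exists_norm_le_of_continuous hc
  refine integral_pi_eq_of_average_eq (pedge hi hj 0) hc.measurable hM fun e => ?_
  simp_rw [xObsG, holG_mulSingle_zero hi hj hij hL]
  exact integral_trRe_mul h 1 _

/-- **`∫ xObsG² = N θ`**: the plaquette holonomy is Haar distributed, and the second moment of the
character is `N θ` (`OneLink.integral_trRe_sq`). [folklore] -/
theorem integral_xObsG_sq (h : OneLink ρ θ) (hL : 2 ≤ L) :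
    ∫ e, (xObsG ρ hi hj e : ℂ) * (xObsG ρ hi hj e : ℂ)
      ∂(Measure.pi fun _ : LEdge d L a => haarProbability G) = N * θ := by
  have hc : Continuous fun e : LEdge d L a → G => (xObsG ρ hi hj e : ℂ) * (xObsG ρ hi hj e : ℂ) :=
    (Complex.continuous_ofReal.comp (continuous_xObsG ρ hi hj h.cont)).mul
      (Complex.continuous_ofReal.comp (continuous_xObsG ρ hi hj h.cont))
  obtain ⟨M, hM⟩ := exists_norm_le_of_continuous hc
  refine integral_pi_eq_of_average_eq (pedge hi hj 0) hc.measurable hM fun e => ?_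
  simp_rw [xObsG, holG_mulSingle_zero hi hj hij hL, one_mul]
  have h1 := integral_mul_right_eq_self (μ := haarProbability G)
    (fun g : G => (trRe ρ g : ℂ) * (trRe ρ g : ℂ)) (holG hi hj e)
  rw [h1]
  have h2 := integral_trRe_sq h
  apply_fun (fun r : ℝ => (r : ℂ)) at h2
  rw [← integral_complex_ofReal] at h2
  push_cast at h2
  simp_rw [sq] at h2
  exact h2

end Plaquette

/-! ## 4. The tube integral -/

section Tube

variable [SecondCountableTopology G] {ρ} (hij : i ≠ j)
include hij

omit [TopologicalSpace G] [IsTopologicalGroup G] [CompactSpace G] [MeasurableSpace G] [BorelSpace G]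
  [SecondCountableTopology G] in
/-- The other bonds of the plaquette are blind to the bond `pedge k`. [folklore] -/
theorem pedge_mulSingle_ne (hL : 2 ≤ L) {k l : Fin 4} (hkl : l ≠ k) (g : G) (u : LEdge d L a → G) :
    ((Pi.mulSingle (pedge hi hj k) g : LEdge d L a → G) * u) (pedge hi hj l) = u (pedge hi hj l) :=
  mulSingle_mul_apply_ne (fun h => hkl (pedge_injective hi hj hij hL h)) g u

/-- **THE TUBE INTEGRAL**: `∫ tr ρ(tubeWord u e') ∏_{k<4} Re tr ρ(u_k) du = θ⁴ · tr ρ(holG e')`.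
[folklore] -/
theorem integral_tube (h : OneLink ρ θ) (hL : 2 ≤ L) (e' : LEdge d L a → G) :
    ∫ u, (ρ (tubeWord hi hj u e')).trace * ∏ k : Fin 4, (trRe ρ (u (pedge hi hj k)) : ℂ)
        ∂(Measure.pi fun _ : LEdge d L a => haarProbability G) =
      θ ^ 4 * (ρ (holG hi hj e')).trace := by
  have hne : ∀ (k l : Fin 4), l ≠ k → ∀ (g : G) (u : LEdge d L a → G),
      ((Pi.mulSingle (pedge hi hj k) g : LEdge d L a → G) * u) (pedge hi hj l) = u (pedge hi hj l) :=
    fun k l hkl g u => pedge_mulSingle_ne hi hj hij hL hkl g u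
  have hφ : ∀ k : Fin 4, Continuous fun u : LEdge d L a → G => (trRe ρ (u (pedge hi hj k)) : ℂ) :=
    fun k => Complex.continuous_ofReal.comp ((continuous_trRe ρ h.cont).comp (continuous_apply _))
  -- step 1: the bond `pedge 0` (plain letter)
  have e1 : ∀ u : LEdge d L a → G, (ρ (tubeWord hi hj u e')).trace *
      ∏ k : Fin 4, (trRe ρ (u (pedge hi hj k)) : ℂ) =
      (trRe ρ (u (pedge hi hj 0)) : ℂ) * ((1 : Matrix (Fin N) (Fin N) ℂ) * ρ (u (pedge hi hj 0)) *
        ρ (e' (pedge hi hj 0) * u (pedge hi hj 1) * e' (pedge hi hj 1) * (e' (pedge hi hj 2))⁻¹ *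
          (u (pedge hi hj 2))⁻¹ * (e' (pedge hi hj 3))⁻¹ * (u (pedge hi hj 3))⁻¹)).trace *
      ((trRe ρ (u (pedge hi hj 1)) : ℂ) * (trRe ρ (u (pedge hi hj 2)) : ℂ) *
        (trRe ρ (u (pedge hi hj 3)) : ℂ)) := by
    intro u
    simp only [tubeWord, Fin.prod_univ_four, map_mul, Matrix.one_mul, mul_assoc]
    simp only [show (0 : Fin 4) = ⟨0, by omega⟩ from rfl, show (1 : Fin 4) = ⟨1, by omega⟩ from rfl,
      show (2 : Fin 4) = ⟨2, by omega⟩ from rfl, show (3 : Fin 4) = ⟨3, by omega⟩ from rfl]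
    ring
  have key1 := integral_step_mul h (pedge hi hj 0) (X := fun _ => (1 : Matrix (Fin N) (Fin N) ℂ))
    (Y := fun u : LEdge d L a → G => ρ (e' (pedge hi hj 0) * u (pedge hi hj 1) * e' (pedge hi hj 1) *
      (e' (pedge hi hj 2))⁻¹ * (u (pedge hi hj 2))⁻¹ * (e' (pedge hi hj 3))⁻¹ * (u (pedge hi hj 3))⁻¹))
    (R := fun u => (trRe ρ (u (pedge hi hj 1)) : ℂ) * (trRe ρ (u (pedge hi hj 2)) : ℂ) *
      (trRe ρ (u (pedge hi hj 3)) : ℂ))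
    continuous_const (h.cont.comp (by fun_prop)) (((hφ 1).mul (hφ 2)).mul (hφ 3)) (fun _ _ => rfl)
    (fun g u => by simp only [hne 0 1 (by decide), hne 0 2 (by decide), hne 0 3 (by decide)])
    (fun g u => by simp only [hne 0 1 (by decide), hne 0 2 (by decide), hne 0 3 (by decide)])
  beta_reduce at key1
  simp_rw [e1]
  rw [key1]
  -- step 2: the bond `pedge 1` (plain letter)
  have e2 : ∀ u : LEdge d L a → G, ((1 : Matrix (Fin N) (Fin N) ℂ) *
      ρ (e' (pedge hi hj 0) * u (pedge hi hj 1) * e' (pedge hi hj 1) * (e' (pedge hi hj 2))⁻¹ *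
        (u (pedge hi hj 2))⁻¹ * (e' (pedge hi hj 3))⁻¹ * (u (pedge hi hj 3))⁻¹)).trace *
      ((trRe ρ (u (pedge hi hj 1)) : ℂ) * (trRe ρ (u (pedge hi hj 2)) : ℂ) *
        (trRe ρ (u (pedge hi hj 3)) : ℂ)) =
      (trRe ρ (u (pedge hi hj 1)) : ℂ) * (ρ (e' (pedge hi hj 0)) * ρ (u (pedge hi hj 1)) *
        ρ (e' (pedge hi hj 1) * (e' (pedge hi hj 2))⁻¹ * (u (pedge hi hj 2))⁻¹ * (e' (pedge hi hj 3))⁻¹ *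
          (u (pedge hi hj 3))⁻¹)).trace *
      ((trRe ρ (u (pedge hi hj 2)) : ℂ) * (trRe ρ (u (pedge hi hj 3)) : ℂ)) := by
    intro u
    simp only [map_mul, Matrix.one_mul, mul_assoc]
    ring
  have key2 := integral_step_mul h (pedge hi hj 1) (X := fun _ => ρ (e' (pedge hi hj 0)))
    (Y := fun u : LEdge d L a → G => ρ (e' (pedge hi hj 1) * (e' (pedge hi hj 2))⁻¹ *
      (u (pedge hi hj 2))⁻¹ * (e' (pedge hi hj 3))⁻¹ * (u (pedge hi hj 3))⁻¹))
    (R := fun u => (trRe ρ (u (pedge hi hj 2)) : ℂ) * (trRe ρ (u (pedge hi hj 3)) : ℂ))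
    continuous_const (h.cont.comp (by fun_prop)) ((hφ 2).mul (hφ 3)) (fun _ _ => rfl)
    (fun g u => by simp only [hne 1 2 (by decide), hne 1 3 (by decide)])
    (fun g u => by simp only [hne 1 2 (by decide), hne 1 3 (by decide)])
  beta_reduce at key2
  simp_rw [e2]
  rw [key2]
  -- step 3: the bond `pedge 2` (inverted letter)
  have e3 : ∀ u : LEdge d L a → G, (ρ (e' (pedge hi hj 0)) *
      ρ (e' (pedge hi hj 1) * (e' (pedge hi hj 2))⁻¹ * (u (pedge hi hj 2))⁻¹ * (e' (pedge hi hj 3))⁻¹ *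
        (u (pedge hi hj 3))⁻¹)).trace *
      ((trRe ρ (u (pedge hi hj 2)) : ℂ) * (trRe ρ (u (pedge hi hj 3)) : ℂ)) =
      (trRe ρ (u (pedge hi hj 2)) : ℂ) *
        (ρ (e' (pedge hi hj 0) * e' (pedge hi hj 1) * (e' (pedge hi hj 2))⁻¹) * ρ (u (pedge hi hj 2))⁻¹ *
          ρ ((e' (pedge hi hj 3))⁻¹ * (u (pedge hi hj 3))⁻¹)).trace *
      (trRe ρ (u (pedge hi hj 3)) : ℂ) := by
    intro u
    simp only [map_mul, mul_assoc]
    ring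
  have key3 := integral_step_inv h (pedge hi hj 2)
    (X := fun _ => ρ (e' (pedge hi hj 0) * e' (pedge hi hj 1) * (e' (pedge hi hj 2))⁻¹))
    (Y := fun u : LEdge d L a → G => ρ ((e' (pedge hi hj 3))⁻¹ * (u (pedge hi hj 3))⁻¹))
    (R := fun u => (trRe ρ (u (pedge hi hj 3)) : ℂ))
    continuous_const (h.cont.comp (by fun_prop)) (hφ 3) (fun _ _ => rfl)
    (fun g u => by simp only [hne 2 3 (by decide)])
    (fun g u => by simp only [hne 2 3 (by decide)])
  beta_reduce at key3
  simp_rw [e3]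
  rw [key3]
  -- step 4: the bond `pedge 3` (inverted letter)
  have e4 : ∀ u : LEdge d L a → G,
      (ρ (e' (pedge hi hj 0) * e' (pedge hi hj 1) * (e' (pedge hi hj 2))⁻¹) *
        ρ ((e' (pedge hi hj 3))⁻¹ * (u (pedge hi hj 3))⁻¹)).trace * (trRe ρ (u (pedge hi hj 3)) : ℂ) =
      (trRe ρ (u (pedge hi hj 3)) : ℂ) *
        (ρ (e' (pedge hi hj 0) * e' (pedge hi hj 1) * (e' (pedge hi hj 2))⁻¹ * (e' (pedge hi hj 3))⁻¹) *
          ρ (u (pedge hi hj 3))⁻¹ * (1 : Matrix (Fin N) (Fin N) ℂ)).trace * (1 : ℂ) := by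
    intro u
    simp only [map_mul, mul_one, mul_assoc]
    ring
  have key4 := integral_step_inv h (pedge hi hj 3)
    (X := fun _ => ρ (e' (pedge hi hj 0) * e' (pedge hi hj 1) * (e' (pedge hi hj 2))⁻¹ *
      (e' (pedge hi hj 3))⁻¹))
    (Y := fun _ : LEdge d L a → G => (1 : Matrix (Fin N) (Fin N) ℂ)) (R := fun _ => (1 : ℂ))
    continuous_const continuous_const continuous_const (fun _ _ => rfl) (fun _ _ => rfl)
    (fun _ _ => rfl)
  beta_reduce at key4
  simp_rw [e4]
  rw [key4]
  simp only [mul_one, integral_const, probReal_univ, one_smul, holG]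
  ring

/-- **THE TUBE INTEGRAL, real form**: `∫ Re tr ρ(tubeWord u e') ∏_{k<4} Re tr ρ(u_k) du =
θ⁴ · xObsG ρ e'` — the eigenvalue of the centred order-four kernel on the plaquette observable
(sequel file). [folklore] -/
theorem integral_trRe_tube (h : OneLink ρ θ) (hL : 2 ≤ L) (e' : LEdge d L a → G) :
    ∫ u, (trRe ρ (tubeWord hi hj u e') : ℂ) * ∏ k : Fin 4, (trRe ρ (u (pedge hi hj k)) : ℂ)
        ∂(Measure.pi fun _ : LEdge d L a => haarProbability G) =
      θ ^ 4 * xObsG ρ hi hj e' := by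
  have hT := integral_tube hi hj hij h hL e'
  -- the conjugate word integrates to the conjugate
  have hconj : ∫ u, (ρ (tubeWord hi hj u e')⁻¹).trace * ∏ k : Fin 4, (trRe ρ (u (pedge hi hj k)) : ℂ)
      ∂(Measure.pi fun _ : LEdge d L a => haarProbability G) =
      θ ^ 4 * (ρ (holG hi hj e')⁻¹).trace := by
    have h1 : (fun u : LEdge d L a → G => (ρ (tubeWord hi hj u e')⁻¹).trace *
        ∏ k : Fin 4, (trRe ρ (u (pedge hi hj k)) : ℂ)) = fun u =>
        (starRingEnd ℂ) ((ρ (tubeWord hi hj u e')).trace *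
          ∏ k : Fin 4, (trRe ρ (u (pedge hi hj k)) : ℂ)) := by
      funext u
      rw [map_mul, map_prod, h.trace_inv, Complex.star_def]
      simp only [Complex.conj_ofReal]
    rw [h1, integral_conj, hT, map_mul, map_pow, Complex.conj_ofReal, h.trace_inv, Complex.star_def]
  have hsum : ∀ u : LEdge d L a → G, (trRe ρ (tubeWord hi hj u e') : ℂ) *
      ∏ k : Fin 4, (trRe ρ (u (pedge hi hj k)) : ℂ) =
      2⁻¹ * ((ρ (tubeWord hi hj u e')).trace * ∏ k : Fin 4, (trRe ρ (u (pedge hi hj k)) : ℂ)) +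
      2⁻¹ * ((ρ (tubeWord hi hj u e')⁻¹).trace * ∏ k : Fin 4, (trRe ρ (u (pedge hi hj k)) : ℂ)) := by
    intro u
    rw [trRe_eq_half_add h.trace_inv]
    ring
  -- integrability of the two halves
  have hc1 : Continuous fun u : LEdge d L a → G => (ρ (tubeWord hi hj u e')).trace *
      ∏ k : Fin 4, (trRe ρ (u (pedge hi hj k)) : ℂ) := by
    refine (h.cont.comp ((continuous_tubeWord hi hj).comp
      (continuous_id.prodMk continuous_const))).matrix_trace.mul ?_
    exact continuous_finsetProd _ fun k _ =>
      Complex.continuous_ofReal.comp ((continuous_trRe ρ h.cont).comp (continuous_apply _))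
  have hc2 : Continuous fun u : LEdge d L a → G => (ρ (tubeWord hi hj u e')⁻¹).trace *
      ∏ k : Fin 4, (trRe ρ (u (pedge hi hj k)) : ℂ) := by
    refine (h.cont.comp ((continuous_tubeWord hi hj).comp
      (continuous_id.prodMk continuous_const)).inv).matrix_trace.mul ?_
    exact continuous_finsetProd _ fun k _ =>
      Complex.continuous_ofReal.comp ((continuous_trRe ρ h.cont).comp (continuous_apply _))
  obtain ⟨M1, hM1⟩ := exists_norm_le_of_continuous hc1
  obtain ⟨M2, hM2⟩ := exists_norm_le_of_continuous hc2
  have hi1 : Integrable (fun u : LEdge d L a → G => (ρ (tubeWord hi hj u e')).trace *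
      ∏ k : Fin 4, (trRe ρ (u (pedge hi hj k)) : ℂ)) (Measure.pi fun _ => haarProbability G) :=
    Integrable.of_bound hc1.measurable.aestronglyMeasurable _ (Eventually.of_forall hM1)
  have hi2 : Integrable (fun u : LEdge d L a → G => (ρ (tubeWord hi hj u e')⁻¹).trace *
      ∏ k : Fin 4, (trRe ρ (u (pedge hi hj k)) : ℂ)) (Measure.pi fun _ => haarProbability G) :=
    Integrable.of_bound hc2.measurable.aestronglyMeasurable _ (Eventually.of_forall hM2)
  simp_rw [hsum]
  rw [integral_add (hi1.const_mul _) (hi2.const_mul _), integral_const_mul, integral_const_mul, hT,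
    hconj, xObsG, trRe_eq_half_add h.trace_inv]
  ring

end Tube

end Summit.Ventures.LatticeQCDFlow.Theory2.GroupLayer

end
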